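import Mathlib
import Summits.Ventures.PercRepro2.Defs
import Summits.Ventures.PercRepro2.Graph
import Summits.Ventures.PercRepro2.Induced
import Summits.Ventures.PercRepro2.VdBKahn
import Summits.Ventures.PercRepro2.ReimerVdBK
import Summits.Ventures.PercRepro2.ReimerVdBKRegions
import Summits.Ventures.PercRepro2.ReimerVdBKZClosed
import Summits.Ventures.PercRepro2.ReimerVdBKZReduction
import Summits.Ventures.PercRepro2.ReimerVdBKZSplit
import Summits.Ventures.PercRepro2.ReimerVdBKZRecursion
import Summits.Ventures.PercRepro2.ReimerVdBKTypeWeight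
import Summits.Ventures.PercRepro2.ReimerVdBKPairType
import Summits.Ventures.PercRepro2.ReimerVdBKCoreDown
import Summits.Ventures.PercRepro2.ReimerVdBKCoreD
import Summits.Ventures.PercRepro2.ReimerVdBKDegTwoGraph
import Summits.Ventures.PercRepro2.ReimerVdBKDegTwoFlip
import Summits.Ventures.PercRepro2.ReimerVdBKDegTwoExpansion
import Summits.Ventures.PercRepro2.ReimerVdBKDegTwoCalc
import Summits.Ventures.PercRepro2.ReimerVdBKLeafGadget
import Summits.Ventures.PercRepro2.ReimerVdBKTwisted
import Summits.Ventures.PercRepro2.ReimerVdBKTied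
import Summits.Ventures.PercRepro2.ReimerVdBKDegThreeGraph
import Summits.Ventures.PercRepro2.ReimerVdBKDegThreeExpansion
import Summits.Ventures.PercRepro2.ReimerVdBKDegThreeCalc

/-!
# The degree-3 expansion, IV: the rule with further core-avoided vertices (the calculus form)
(blind cell PercRepro2, mine-c g48; `conjectures/MINE-C.md` §56.7 (b), §57)

Summing the pointwise split of `ReimerVdBKDegThreeCalc`: `4 · coreCount A X B Y (insert v N) =
4 · coreTiedCount A X B Y N {e₁, e₂, e₃} + Σ_k coreGensym3Count(G⁺_k)` (`four_mul_coreCount_insert_deg3`),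
and THEOREM `coreDown_insert_of_genSym3N`: (CORE↓) at `N` on the TIED sub-cube of the star (`CoreDownTied`)
and the `N`-weighted GENSYM3 on the three class graphs `G⁺_k` give (CORE↓) at `insert v N` on `G` — the
DEGREE-3 RULE of the calculus, verbatim the degree-2 rule `coreDown_insert_of_genSymN`; with `N = ∅` it
is `coreDown_of_genSym3` (`coreDown_of_genSym3N_empty`).  The tied hypothesis is the first
block-coordinate statement of the line: (CORE↓) at `N` on the product space with the star of `v` as one
coordinate (`MINE-C.md` §56.8, the tied class of (VCLASS)).
-/

namespace Summit.Ventures.PercRepro2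
namespace ReimerVdBK
open Classical

variable {V : Type*} {E : Type*} [Fintype E] [DecidableEq E] [Fintype V] [DecidableEq V]
variable (ends : E → Sym2 V) (s : V)

section Expansion
variable {v u₁ u₂ u₃ : V} {e₁ e₂ e₃ : E} (A X B Y N : Finset V)

/-- **The degree-3 expansion with `N`**: `4 · coreCount A X B Y (insert v N) = 4 · coreTiedCount A X B Y N
{e₁, e₂, e₃} + Σ_k coreGensym3Count(G⁺_k)`. -/
theorem four_mul_coreCount_insert_deg3 (hd : Deg3 ends v u₁ u₂ u₃ e₁ e₂ e₃) (hsv : s ≠ v)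
    (hv : v ∉ A ∪ X ∪ B ∪ Y) (hvN : v ∉ N) :
    4 * coreCount ends s A X B Y (insert v N) =
      4 * coreTiedCount ends s A X B Y N {e₁, e₂, e₃} +
        (coreGensym3Count (endsP3 ends v u₁ u₂ e₁ e₂ e₃) s A X B Y N e₁ u₁ u₃ +
          (coreGensym3Count (endsP3 ends v u₃ u₁ e₃ e₁ e₂) s A X B Y N e₃ u₃ u₂ +
            coreGensym3Count (endsP3 ends v u₂ u₃ e₂ e₃ e₁) s A X B Y N e₂ u₂ u₁)) := by
  -- the pointwise split, summed
  have hsplit : ∑ ω : Config E, coreTermN ends s A X B Y N v ω =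
      ∑ ω : Config E, (if ω e₁ = ω e₂ ∧ ω e₂ = ω e₃ then tiedFunN ends s A X B Y N {e₁, e₂, e₃} ω else 0) +
        (∑ ω : Config E, (if ω e₁ = ω e₂ ∧ ω e₂ ≠ ω e₃ then
            classFun3N s A X B Y N (endsP3 ends v u₁ u₂ e₁ e₂ e₃) e₁ u₁ u₃ ω else 0) +
          (∑ ω : Config E, (if ω e₁ ≠ ω e₂ ∧ ω e₁ = ω e₃ then
              classFun3N s A X B Y N (endsP3 ends v u₃ u₁ e₃ e₁ e₂) e₃ u₃ u₂ ω else 0) +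
            ∑ ω : Config E, (if ω e₁ ≠ ω e₂ ∧ ω e₁ ≠ ω e₃ then
              classFun3N s A X B Y N (endsP3 ends v u₂ u₃ e₂ e₃ e₁) e₂ u₂ u₁ ω else 0))) := by
    rw [← sum_sel3]
    exact Finset.sum_congr rfl fun ω _ => term_split3N ends s A X B Y N hd hsv hv hvN ω
  -- the monochromatic part is the tied count
  have hM : ∑ ω : Config E, (if ω e₁ = ω e₂ ∧ ω e₂ = ω e₃ then tiedFunN ends s A X B Y N {e₁, e₂, e₃} ω else 0) =
      coreTiedCount ends s A X B Y N {e₁, e₂, e₃} := by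
    unfold coreTiedCount
    refine Finset.sum_congr rfl fun ω _ => ?_
    by_cases hm : ω e₁ = ω e₂ ∧ ω e₂ = ω e₃
    · rw [if_pos hm]
    · rw [if_neg hm, tiedFunN_eq_zero_of_not_mono ends s A X B Y N hd hm]
  -- the three classes
  have hG3 := four_mul_sum_class e₁ e₂ e₃ hd.ne12 hd.ne13 hd.ne23
    (classFun3N s A X B Y N (endsP3 ends v u₁ u₂ e₁ e₂ e₃) e₁ u₁ u₃)
    (fun ω => classFun3N_flip ends s A X B Y N hd (Or.inl rfl) ω)
    (fun ω => classFun3N_flip ends s A X B Y N hd (Or.inr rfl) ω)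
  have hG2 := four_mul_sum_class e₃ e₁ e₂ hd.ne13.symm hd.ne23.symm hd.ne12
    (classFun3N s A X B Y N (endsP3 ends v u₃ u₁ e₃ e₁ e₂) e₃ u₃ u₂)
    (fun ω => classFun3N_flip ends s A X B Y N hd.rot.rot (Or.inl rfl) ω)
    (fun ω => classFun3N_flip ends s A X B Y N hd.rot.rot (Or.inr rfl) ω)
  have hG1 := four_mul_sum_class e₂ e₃ e₁ hd.ne23 hd.ne12.symm hd.ne13.symm
    (classFun3N s A X B Y N (endsP3 ends v u₂ u₃ e₂ e₃ e₁) e₂ u₂ u₁)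
    (fun ω => classFun3N_flip ends s A X B Y N hd.rot (Or.inl rfl) ω)
    (fun ω => classFun3N_flip ends s A X B Y N hd.rot (Or.inr rfl) ω)
  -- the class conditions in the rotated form
  have c2 : ∑ ω : Config E, (if ω e₁ ≠ ω e₂ ∧ ω e₁ = ω e₃ then
        classFun3N s A X B Y N (endsP3 ends v u₃ u₁ e₃ e₁ e₂) e₃ u₃ u₂ ω else 0) =
      ∑ ω : Config E, (if ω e₃ = ω e₁ ∧ ω e₁ ≠ ω e₂ then
        classFun3N s A X B Y N (endsP3 ends v u₃ u₁ e₃ e₁ e₂) e₃ u₃ u₂ ω else 0) := by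
    refine Finset.sum_congr rfl fun ω _ => ?_
    by_cases h : ω e₁ ≠ ω e₂ ∧ ω e₁ = ω e₃
    · rw [if_pos h, if_pos (show ω e₃ = ω e₁ ∧ ω e₁ ≠ ω e₂ from ⟨h.2.symm, h.1⟩)]
    · rw [if_neg h, if_neg (show ¬ (ω e₃ = ω e₁ ∧ ω e₁ ≠ ω e₂) from fun h' => h ⟨h'.2, h'.1.symm⟩)]
  have c1 : ∑ ω : Config E, (if ω e₁ ≠ ω e₂ ∧ ω e₁ ≠ ω e₃ then
        classFun3N s A X B Y N (endsP3 ends v u₂ u₃ e₂ e₃ e₁) e₂ u₂ u₁ ω else 0) =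
      ∑ ω : Config E, (if ω e₂ = ω e₃ ∧ ω e₃ ≠ ω e₁ then
        classFun3N s A X B Y N (endsP3 ends v u₂ u₃ e₂ e₃ e₁) e₂ u₂ u₁ ω else 0) := by
    refine Finset.sum_congr rfl fun ω _ => ?_
    by_cases h : ω e₁ ≠ ω e₂ ∧ ω e₁ ≠ ω e₃
    · have h23 : ω e₂ = ω e₃ := by
        cases k1 : ω e₁ <;> cases k2 : ω e₂ <;> cases k3 : ω e₃ <;> simp_all
      rw [if_pos h, if_pos (show ω e₂ = ω e₃ ∧ ω e₃ ≠ ω e₁ from ⟨h23, fun h' => h.2 h'.symm⟩)]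
    · rw [if_neg h, if_neg (show ¬ (ω e₂ = ω e₃ ∧ ω e₃ ≠ ω e₁) from ?_)]
      rintro ⟨h23, h31⟩
      apply h
      exact ⟨fun h12 => h31 (h23.symm.trans h12.symm), fun h13 => h31 h13.symm⟩
  rw [coreCount_insert_eq_sum_coreTermN, hsplit, hM, c2, c1]
  unfold coreGensym3Count
  generalize (∑ ω : Config E, (if ω e₁ = ω e₂ ∧ ω e₂ ≠ ω e₃ then
    classFun3N s A X B Y N (endsP3 ends v u₁ u₂ e₁ e₂ e₃) e₁ u₁ u₃ ω else 0)) = S3 at hG3 ⊢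
  generalize (∑ ω : Config E, classFun3N s A X B Y N (endsP3 ends v u₁ u₂ e₁ e₂ e₃) e₁ u₁ u₃ ω) = T3
    at hG3 ⊢
  generalize (∑ ω : Config E, (if ω e₃ = ω e₁ ∧ ω e₁ ≠ ω e₂ then
    classFun3N s A X B Y N (endsP3 ends v u₃ u₁ e₃ e₁ e₂) e₃ u₃ u₂ ω else 0)) = S2 at hG2 ⊢
  generalize (∑ ω : Config E, classFun3N s A X B Y N (endsP3 ends v u₃ u₁ e₃ e₁ e₂) e₃ u₃ u₂ ω) = T2
    at hG2 ⊢
  generalize (∑ ω : Config E, (if ω e₂ = ω e₃ ∧ ω e₃ ≠ ω e₁ then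
    classFun3N s A X B Y N (endsP3 ends v u₂ u₃ e₂ e₃ e₁) e₂ u₂ u₁ ω else 0)) = S1 at hG1 ⊢
  generalize (∑ ω : Config E, classFun3N s A X B Y N (endsP3 ends v u₂ u₃ e₂ e₃ e₁) e₂ u₂ u₁ ω) = T1
    at hG1 ⊢
  generalize coreTiedCount ends s A X B Y N {e₁, e₂, e₃} = C0
  omega

/-- **The degree-3 rule of the calculus**: (CORE↓) at `N` on the tied sub-cube of the star and the
`N`-weighted GENSYM3 on the three class graphs `G⁺_k` give (CORE↓) at `insert v N` on `G`, for an unmarked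
`v ≠ s` of degree 3 not in `N`. -/
theorem coreDown_insert_of_genSym3N (hd : Deg3 ends v u₁ u₂ u₃ e₁ e₂ e₃) (hsv : s ≠ v)
    (hv : v ∉ A ∪ X ∪ B ∪ Y) (hvN : v ∉ N)
    (hT : CoreDownTied ends s A X B Y N {e₁, e₂, e₃})
    (h3 : GenSym3N (endsP3 ends v u₁ u₂ e₁ e₂ e₃) s A X B Y N e₁ u₁ u₃)
    (h2 : GenSym3N (endsP3 ends v u₃ u₁ e₃ e₁ e₂) s A X B Y N e₃ u₃ u₂)
    (h1 : GenSym3N (endsP3 ends v u₂ u₃ e₂ e₃ e₁) s A X B Y N e₂ u₂ u₁) :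
    CoreDown ends s A X B Y (insert v N) := by
  have hv' : v ∉ (A ∪ B) ∪ ∅ ∪ ∅ ∪ (X ∪ Y) := by
    rw [Finset.union_empty, Finset.union_empty]
    intro h
    rcases Finset.mem_union.1 h with h | h <;> rcases Finset.mem_union.1 h with h | h
    · exact hv (Finset.mem_union_left _ (Finset.mem_union_left _ (Finset.mem_union_left _ h)))
    · exact hv (Finset.mem_union_left _ (Finset.mem_union_right _ h))
    · exact hv (Finset.mem_union_left _ (Finset.mem_union_left _ (Finset.mem_union_right _ h)))
    · exact hv (Finset.mem_union_right _ h)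
  have hL := four_mul_coreCount_insert_deg3 ends s A X B Y N hd hsv hv hvN
  have hR := four_mul_coreCount_insert_deg3 ends s (A ∪ B) ∅ ∅ (X ∪ Y) N hd hsv hv' hvN
  unfold GenSym3N at h1 h2 h3
  unfold CoreDownTied at hT
  unfold CoreDown
  have : 4 * coreCount ends s A X B Y (insert v N) ≤
      4 * coreCount ends s (A ∪ B) ∅ ∅ (X ∪ Y) (insert v N) := by
    rw [hL, hR]
    exact Nat.add_le_add (Nat.mul_le_mul_left 4 hT) (Nat.add_le_add h3 (Nat.add_le_add h2 h1))
  exact Nat.le_of_mul_le_mul_left this (by norm_num)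

/-- With `N = ∅` the rule is `coreDown_of_genSym3`: the tied hypothesis is Harris on the tied sub-cube. -/
theorem coreDown_of_genSym3N_empty (hd : Deg3 ends v u₁ u₂ u₃ e₁ e₂ e₃) (hsv : s ≠ v)
    (hv : v ∉ A ∪ X ∪ B ∪ Y) (hXY : X ∩ Y = ∅)
    (h3 : GenSym3N (endsP3 ends v u₁ u₂ e₁ e₂ e₃) s A X B Y ∅ e₁ u₁ u₃)
    (h2 : GenSym3N (endsP3 ends v u₃ u₁ e₃ e₁ e₂) s A X B Y ∅ e₃ u₃ u₂)
    (h1 : GenSym3N (endsP3 ends v u₂ u₃ e₂ e₃ e₁) s A X B Y ∅ e₂ u₂ u₁) :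
    CoreDown ends s A X B Y {v} := by
  have h := coreDown_insert_of_genSym3N ends s A X B Y ∅ hd hsv hv (Finset.notMem_empty v)
    (coreDownTied_of_empty ends s A X B Y {e₁, e₂, e₃} hXY) h3 h2 h1
  rwa [Finset.insert_empty] at h

end Expansion

end ReimerVdBK
end Summit.Ventures.PercRepro2
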